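import Mathlib

/-!
# The third-difference operator on a cycle is skew: its quadratic form vanishes

Finite-dimensional kernel of solo-blind paper §24.17: in the columnar (n = ∞) limit the mean-flow
feedback operator `𝓛` of the reduced pattern problem (§24.16(11)) acting on the leaf intensity `q`
has a THIRD-ORDER leading part `-α₃ q‴` (reprofiling response of a forced carrier, circulation law on
its leaves).  A third-order (central) difference or differential operator with constant coefficient is
skew-adjoint, so its quadratic form is identically zero: coercivity of the Landau operator — the
hypothesis of `lcp_unique_of_posDef` (SoloBlindLCPUnique) — can only come from the lower-order, even
part.  Here: for `q : ZMod N → ℝ`, `∑ i, q i * (q (i+2) - 2 q (i+1) + 2 q (i-1) - q (i-2)) = 0`, from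
the shift identity `∑ i, q i * q (i + k) = ∑ i, q i * q (i - k)`.
-/

namespace Summit.AnomalousDissipation.AnomalousDissipation.Theorems

open Finset

/-- Shift symmetry of the autocorrelation on a cycle: `∑ qᵢ qᵢ₊ₖ = ∑ qᵢ qᵢ₋ₖ`. -/
theorem sum_mul_shift_eq {N : ℕ} [NeZero N] (q : ZMod N → ℝ) (k : ZMod N) :
    ∑ i, q i * q (i + k) = ∑ i, q i * q (i - k) := by
  have h := Fintype.sum_equiv (Equiv.addRight k) (fun i => q i * q (i + k))
    (fun j => q (j - k) * q j) (by intro i; simp)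
  rw [h]
  exact Finset.sum_congr rfl (fun j _ => mul_comm _ _)

/-- The central third difference `(δ³q)ᵢ = qᵢ₊₂ - 2qᵢ₊₁ + 2qᵢ₋₁ - qᵢ₋₂` on the cycle `ZMod N` is skew:
`⟨q, δ³ q⟩ = 0` for every `q`. -/
theorem third_difference_form_eq_zero {N : ℕ} [NeZero N] (q : ZMod N → ℝ) :
    ∑ i, q i * (q (i + 2) - 2 * q (i + 1) + 2 * q (i - 1) - q (i - 2)) = 0 := by
  have h1 := sum_mul_shift_eq q 1
  have h2 := sum_mul_shift_eq q 2
  have e : ∀ i, q i * (q (i + 2) - 2 * q (i + 1) + 2 * q (i - 1) - q (i - 2)) =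
      (q i * q (i + 2) - q i * q (i - 2)) - 2 * (q i * q (i + 1) - q i * q (i - 1)) := by
    intro i; ring
  rw [Finset.sum_congr rfl (fun i _ => e i), Finset.sum_sub_distrib, Finset.sum_sub_distrib,
    ← Finset.mul_sum, Finset.sum_sub_distrib, h1, h2]
  ring

/-- Consequently an operator `Q q = δ³ q + E q` has the same quadratic form as its even part `E`:
positivity of `⟨q, Q q⟩` is positivity of `⟨q, E q⟩`. -/
theorem form_eq_even_part {N : ℕ} [NeZero N] (q : ZMod N → ℝ) (E : (ZMod N → ℝ) → (ZMod N → ℝ)) :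
    ∑ i, q i * ((q (i + 2) - 2 * q (i + 1) + 2 * q (i - 1) - q (i - 2)) + E q i) =
      ∑ i, q i * E q i := by
  have h := third_difference_form_eq_zero q
  have : ∀ i, q i * ((q (i + 2) - 2 * q (i + 1) + 2 * q (i - 1) - q (i - 2)) + E q i) =
      q i * (q (i + 2) - 2 * q (i + 1) + 2 * q (i - 1) - q (i - 2)) + q i * E q i := by
    intro i; ring
  rw [Finset.sum_congr rfl (fun i _ => this i), Finset.sum_add_distrib, h, zero_add]

end Summit.AnomalousDissipation.AnomalousDissipation.Theorems
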